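import Mathlib.Analysis.SpecialFunctions.Pow.Real
import Literature.Geometry.DiscreteGeometry.KissingPatterns
import Literature.MathematicalPhysics.StatisticalMechanics.StablePotentialsProofs
import Summits.AtomisticToContinuum.Crystallization.Theorems.ThreeConeCertificateSlackRigidityThinning
import HarnessLib

/-!
# Line `separation-padding-transfer` (crux `ReggeStarCoercivity.StarCoercivity`, stmt-AtomisticToContinuum-13600): the deletion glue

Stub `stub_deletionGlue` of the line skeleton: SEPARATION IS REMOVABLE in the star-coercivity
inequality, with explicit constants.  Write `e = ⨅_Q e(Q)` (the periodic Lennard-Jones energy per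
particle), `E(x) = ∑_{i<j} V_LJ(|xᵢ − xⱼ|)` and `#Def(x)` for the number of star-defective sites of
`x : Fin N → ℝ³` (sites whose recentred `6/5`-shell, rescaled by some `a ∈ [9/10, 11/10]`, is not
`1/20`-close to the fcc or the hcp kissing pattern).  GIVEN the defect-count bound under deletion
of one particle, `#Def(x) ≤ #Def(x ∘ i₀.succAbove) + 56` (hypothesis; it is supplied by the other
stubs of the line), and given `g > 0`, `e < 0`: if
`N·e + g·#Def(x) − C·N^(2/3) ≤ E(x)` holds for all `1/3`-SEPARATED injective configurations, then
`N·e + min g (−e/56)·#Def(x) − max C 0·N^(2/3) ≤ E(x)` holds for ALL injective configurations.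

Proof: induction on `N`.  A separated configuration is covered by the hypothesis
(`min g (−e/56) ≤ g`, `#Def ≥ 0`, `C ≤ max C 0`, `N^(2/3) ≥ 0`).  Otherwise two points are at
distance `< 1/3`, and `exists_le_siteEnergy_of_dist_lt` (closest pair + shell sum) gives a particle
`i₀` with site energy `≥ 729·229/12 > 0`; by the removal identity
`interactionEnergy_eq_succAbove_add_siteEnergy`, `E(x ∘ i₀.succAbove) < E(x)`.  The induction
hypothesis for the `N − 1` remaining points, the defect-count bound (`+56` defects cost
`56·min g (−e/56) ≤ −e`, exactly the `e` gained on the left) and `(N−1)^(2/3) ≤ N^(2/3)` close the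
step.  All `[folklore]`; the arithmetic is isolated in `sep_arith` / `step_arith`.
-/

noncomputable section

namespace Summit.AtomisticToContinuum.Crystallization.Theorems.SeparationPaddingTransfer

open scoped BigOperators Classical
open Literature.MathematicalPhysics.StatisticalMechanics Literature.Geometry.DiscreteGeometry
open Summit.AtomisticToContinuum.Crystallization.Theorems.CLayerWitnessThinning
  (exists_le_siteEnergy_of_dist_lt)

/-- Arithmetic of the separated case: weakening the constants `g ↦ min g (−e/56)`, `C ↦ max C 0`
preserves the inequality since `D ≥ 0` and `r ≥ 0`. -/
theorem sep_arith {e g C N D r Ex : ℝ} (hD : 0 ≤ D) (hr : 0 ≤ r)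
    (h : N * e + g * D - C * r ≤ Ex) : N * e + min g (-e / 56) * D - max C 0 * r ≤ Ex := by
  have h1 : min g (-e / 56) * D ≤ g * D := mul_le_mul_of_nonneg_right (min_le_left _ _) hD
  have h2 : C * r ≤ max C 0 * r := mul_le_mul_of_nonneg_right (le_max_left _ _) hr
  linarith

/-- Arithmetic of the deletion step: with `g' = min g (−e/56) ≥ 0`, `56·g' ≤ −e`, `C' = max C 0 ≥ 0`,
from `D ≤ D' + 56`, `r' ≤ r`, `s ≥ 729·229/12`, `Ex = Ex' + s` and the induction hypothesis
`n·e + g'·D' − C'·r' ≤ Ex'` one gets `(n+1)·e + g'·D − C'·r ≤ Ex`. -/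
theorem step_arith {e g C n D D' r r' Ex Ex' s : ℝ} (hg : 0 < g) (he : e < 0)
    (hD : D ≤ D' + 56) (hr : r' ≤ r) (hs : 729 * 229 / 12 ≤ s)
    (hE : Ex = Ex' + s) (ih : n * e + min g (-e / 56) * D' - max C 0 * r' ≤ Ex') :
    (n + 1) * e + min g (-e / 56) * D - max C 0 * r ≤ Ex := by
  have hg' : 0 ≤ min g (-e / 56) := le_min hg.le (by linarith)
  have h56 : min g (-e / 56) ≤ -e / 56 := min_le_right _ _
  have hC' : 0 ≤ max C 0 := le_max_right _ _
  have h1 : min g (-e / 56) * D ≤ min g (-e / 56) * (D' + 56) := mul_le_mul_of_nonneg_left hD hg'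
  have h2 : max C 0 * r' ≤ max C 0 * r := mul_le_mul_of_nonneg_left hr hC'
  linarith

/-- **Stub `stub_deletionGlue` — separation is removable (closest-pair deletion, explicit constants).**
Given the defect-count bound under deletion `#Def(x) ≤ #Def(x ∘ i₀.succAbove) + 56` (hypothesis),
`g > 0` and `e = ⨅_Q e(Q) < 0`: if `N·e + g·#Def(x) − C·N^(2/3) ≤ E_LJ(x)` for all `1/3`-separated
injective `x : Fin N → ℝ³`, then `N·e + min g (−e/56)·#Def(x) − max C 0·N^(2/3) ≤ E_LJ(x)` for all
injective `x`.  Induction on `N`, deleting a particle of site energy `≥ 729·229/12`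
(`exists_le_siteEnergy_of_dist_lt`, `interactionEnergy_eq_succAbove_add_siteEnergy`). [folklore] -/
theorem stub_deletionGlue : (∀ (N : ℕ) (x : Fin (N + 1) → EuclideanSpace ℝ (Fin 3)) (i₀ : Fin (N + 1)), Function.Injective x → Nat.card {i : Fin (N + 1) // ¬ ∃ a : ℝ, 9 / 10 ≤ a ∧ a ≤ 11 / 10 ∧ (Literature.Geometry.DiscreteGeometry.ShellCloseTo (1 / 20) ((Finset.univ.filter fun j : Fin (N + 1) => j ≠ i ∧ dist (x i) (x j) ≤ 6 / 5).image fun j => a⁻¹ • (x j - x i)) Literature.Geometry.DiscreteGeometry.fccKissingPattern ∨ Literature.Geometry.DiscreteGeometry.ShellCloseTo (1 / 20) ((Finset.univ.filter fun j : Fin (N + 1) => j ≠ i ∧ dist (x i) (x j) ≤ 6 / 5).image fun j => a⁻¹ • (x j - x i)) Literature.Geometry.DiscreteGeometry.hcpKissingPattern)} ≤ Nat.card {i : Fin N // ¬ ∃ a : ℝ, 9 / 10 ≤ a ∧ a ≤ 11 / 10 ∧ (Literature.Geometry.DiscreteGeometry.ShellCloseTo (1 / 20) ((Finset.univ.filter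 fun j : Fin N => j ≠ i ∧ dist (x (Fin.succAbove i₀ i)) (x (Fin.succAbove i₀ j)) ≤ 6 / 5).image fun j => a⁻¹ • (x (Fin.succAbove i₀ j) - x (Fin.succAbove i₀ i))) Literature.Geometry.DiscreteGeometry.fccKissingPattern ∨ Literature.Geometry.DiscreteGeometry.ShellCloseTo (1 / 20) ((Finset.univ.filter fun j : Fin N => j ≠ i ∧ dist (x (Fin.succAbove i₀ i)) (x (Fin.succAbove i₀ j)) ≤ 6 / 5).image fun j => a⁻¹ • (x (Fin.succAbove i₀ j) - x (Fin.succAbove i₀ i))) Literature.Geometry.DiscreteGeometry.hcpKissingPattern)} + 56) → ∀ g C : ℝ, 0 < g → (⨅ Q : Literature.MathematicalPhysics.StatisticalMechanics.PeriodicConfiguration 3, Q.energyPerParticle Literature.MathematicalPhysics.StatisticalMechanics.lennardJones) < 0 → (∀ (N : ℕ) (x : Fin N → EuclideanSpace ℝ (Fin 3)), Function.Injective x → (∀ i j : Fin N, i ≠ j → (1 / 3 : ℝ) ≤ dist (x i) (x j)) → (N : ℝ) * (⨅ Q : Literature.MathematicalPhysics.StatisticalMechanics.PeriodicConfiguration 3,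 Q.energyPerParticle Literature.MathematicalPhysics.StatisticalMechanics.lennardJones) + g * (Nat.card {i : Fin N // ¬ ∃ a : ℝ, 9 / 10 ≤ a ∧ a ≤ 11 / 10 ∧ (Literature.Geometry.DiscreteGeometry.ShellCloseTo (1 / 20) ((Finset.univ.filter fun j : Fin N => j ≠ i ∧ dist (x i) (x j) ≤ 6 / 5).image fun j => a⁻¹ • (x j - x i)) Literature.Geometry.DiscreteGeometry.fccKissingPattern ∨ Literature.Geometry.DiscreteGeometry.ShellCloseTo (1 / 20) ((Finset.univ.filter fun j : Fin N => j ≠ i ∧ dist (x i) (x j) ≤ 6 / 5).image fun j => a⁻¹ • (x j - x i)) Literature.Geometry.DiscreteGeometry.hcpKissingPattern)} : ℝ) - C * (N : ℝ) ^ (2 / 3 : ℝ) ≤ Literature.MathematicalPhysics.StatisticalMechanics.interactionEnergy Literature.MathematicalPhysics.StatisticalMechanics.lennardJones x) → ∀ (N : ℕ) (x : Fin N → EuclideanSpace ℝ (Fin 3)), Function.Injective x → (N : ℝ) * (⨅ Q : Literature.MathematicalPhysics.StatisticalMechanics.PeriodicConfiguration 3, Q.energyPerParticle Literature.MathematicalPhysics.StatisticalMechanics.lennardJones)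 + min g (-(⨅ Q : Literature.MathematicalPhysics.StatisticalMechanics.PeriodicConfiguration 3, Q.energyPerParticle Literature.MathematicalPhysics.StatisticalMechanics.lennardJones) / 56) * (Nat.card {i : Fin N // ¬ ∃ a : ℝ, 9 / 10 ≤ a ∧ a ≤ 11 / 10 ∧ (Literature.Geometry.DiscreteGeometry.ShellCloseTo (1 / 20) ((Finset.univ.filter fun j : Fin N => j ≠ i ∧ dist (x i) (x j) ≤ 6 / 5).image fun j => a⁻¹ • (x j - x i)) Literature.Geometry.DiscreteGeometry.fccKissingPattern ∨ Literature.Geometry.DiscreteGeometry.ShellCloseTo (1 / 20) ((Finset.univ.filter fun j : Fin N => j ≠ i ∧ dist (x i) (x j) ≤ 6 / 5).image fun j => a⁻¹ • (x j - x i)) Literature.Geometry.DiscreteGeometry.hcpKissingPattern)} : ℝ) - max C 0 * (N : ℝ) ^ (2 / 3 : ℝ) ≤ Literature.MathematicalPhysics.StatisticalMechanics.interactionEnergy Literature.MathematicalPhysics.StatisticalMechanics.lennardJones x := by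
  intro hD g C hg he hsep N
  induction N with
  | zero =>
    intro x hx
    exact sep_arith (Nat.cast_nonneg _) (Real.rpow_nonneg (Nat.cast_nonneg _) _)
      (hsep 0 x hx fun i => i.elim0)
  | succ n ih =>
    intro x hx
    by_cases hs : ∀ i j : Fin (n + 1), i ≠ j → (1 / 3 : ℝ) ≤ dist (x i) (x j)
    · exact sep_arith (Nat.cast_nonneg _) (Real.rpow_nonneg (Nat.cast_nonneg _) _)
        (hsep (n + 1) x hx hs)
    push Not at hs
    obtain ⟨i, j, hij, hlt⟩ := hs
    -- delete a particle `i₀` of a closest pair: its site energy is `≥ 729·229/12`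
    obtain ⟨i₀, hi₀⟩ := exists_le_siteEnergy_of_dist_lt hx hij hlt
    have hx' : Function.Injective (fun k => x (i₀.succAbove k)) :=
      hx.comp Fin.succAbove_right_injective
    have hE : interactionEnergy lennardJones x =
        interactionEnergy lennardJones (fun k => x (i₀.succAbove k)) + siteEnergy lennardJones x i₀ :=
      interactionEnergy_eq_succAbove_add_siteEnergy lennardJones lennardJones_zero x i₀
    -- the induction hypothesis for the remaining `n` points and the defect-count bound
    have hih := ih (fun k => x (i₀.succAbove k)) hx'
    beta_reduce at hih
    have hDR := (Nat.cast_le (α := ℝ)).2 (hD n x i₀ hx)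
    push_cast at hDR
    have hrpow : (n : ℝ) ^ (2 / 3 : ℝ) ≤ ((n : ℝ) + 1) ^ (2 / 3 : ℝ) :=
      Real.rpow_le_rpow (Nat.cast_nonneg _) (by linarith) (by norm_num)
    rw [Nat.cast_succ]
    exact step_arith hg he hDR hrpow hi₀ hE hih

end Summit.AtomisticToContinuum.Crystallization.Theorems.SeparationPaddingTransfer

end
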